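import Literature.AlgebraicGeometry.Motives.HodgeThetaAnnihilatorTimesRankOneTorus
import Literature.AlgebraicGeometry.Motives.HodgeLieTimesGluedBlocks
import Literature.AlgebraicGeometry.Motives.HodgeLieProductSimpleFactor
import Literature.AlgebraicGeometry.Motives.HodgeLieReductiveAnyWeight
import HarnessLib

/-!
# `𝔥(H₁ ⊕ H₂) = 𝔥(H₁) × 𝔥(H₂)` for the `H¹` of a CM ELLIPTIC CURVE `H₂ = (V₂, φ₂)` and `H₁` with skew centre `ℚφ₁`, unless the `Θ`-trace
# slopes resonate (Moonen–Zarhin 1999 Lemma (3.6) / Prop. (3.8) «`Hg(X × E) = Hg(X) × Hg(E)` or `End⁰(E) = k` embeds into the centre of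
# `End⁰(X)`», for the Lie algebra `hodgeLie` itself)

Family `hodge`, layer `Literature/AlgebraicGeometry/Motives`; THEOREMS ONLY (no definition, no named fact).  Written for the cell
`pub-hodgecm2` (COR-CM), seat `b27` gen 48 (count-neutral Mumford–Tate-rank ladder; the cell `E × T` for a CM elliptic curve `E` and a
type-IV threefold `T` with a DIFFERENT imaginary quadratic field).  Companion of `Motives/HodgeLieTimesNonCMCurve` (non-CM curve summand,
Moonen–Zarhin Lemma (3.4)).  The tree's `Motives/HodgeThetaAnnihilatorTimesRankOneTorus` (cell `pub-hodge-ring2`) proves the same Lie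
step in the WORD MODEL, for the annihilator algebra `annLie(q)` of one rational tensor; here the argument is run for the Lie algebra
`𝔥(H)` of the Hodge group (the annihilator of ALL Hodge tensors) and pushed to the structural conclusion
`𝔥(H) = ι₁ 𝔥(H₁) π₁ ⊕ ι₂ 𝔥(H₂) π₂`.

SETTING.  `H ≅ H₁ ⊕ H₂` pure `ℚ`-Hodge structures of weight `1`, decomposed by morphisms `ι_i : H_i → H`, `π_i : H → H_i` (`π_i ι_i = id`,
`ι₁ π₁ + ι₂ π₂ = id`); polarizations `ψ` of `H`, `ψ₁` of `H₁`, `ψ₂` of `H₂`.  On `H₂`: `dim_ℚ V₂ = 2`, `H₂` effective, and a Hodge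
endomorphism `φ₂` with `φ₂² = -d₂`, `d₂ > 0` (the `H¹` of an elliptic curve with complex multiplication by `k = ℚ(√-d₂)`; then
`𝔥(H₂) ⊆ ℚφ₂`, `RankTwoCM.exists_eq_ratCast_smul_of_commute_of_skew`).  On `H₁`: a Hodge endomorphism `φ₁` such that EVERY `ψ₁`-SKEW
CENTRAL HODGE ENDOMORPHISM OF `H₁` IS A RATIONAL MULTIPLE OF `φ₁` («the centre of `End⁰(X)` is an imaginary quadratic field `ℚ(φ₁)`»,
type IV with `e₀ = 1`, any multiplicities — Ribet type, Weil type, …).  NO OTHER HYPOTHESIS ON `H₁` (no rigidity, no simplicity).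

RESULTS.
* §2 `exists_restrict₂_eq_smul_of_cmCurve` — `π₂ 𝔥(H) ι₂ ⊆ ℚφ₂`; `restrict₂_commutator_eq_zero_of_cmCurve` — brackets of `𝔥(H)` have zero
  `V₂`-block; `trace_restrict₁_commutator_mul_eq_zero` — and `φ₁`-trace-free `V₁`-block.
* §3 `exists_center_blocks_of_cmCurve` — an element of the centre `𝔷(H) = 𝔥(H) ∩ End_Hdg(H)` has blocks `(x φ₁, y φ₂)`, `x, y ∈ ℚ`;
  `center_dichotomy_of_cmCurve` — EITHER `ι₂ φ₂ π₂ ∈ 𝔥(H)`, OR `𝔷(H) ⊆ ℚ z₀` for one `z₀ ∈ 𝔷(H)` with blocks `(x₀ φ₁, y₀ φ₂)`, `x₀ ≠ 0`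
  or `z₀ = 0`.
* §4 **`incl_comp_proj_mem_hodgeLie_or_exists_traceSlopes_eq`** — the DICHOTOMY: `ι₂ φ₂ π₂ ∈ 𝔥(H)`, or the `Θ`-trace slopes resonate,
  `tr(φ₁²)·tr(Θ₂ φ₂,ℂ) = c·tr(Θ₁ φ₁,ℂ)·tr(φ₂²)` for a RATIONAL `c` (Deligne: `𝔥(H) = 𝔷(H) ⊕ 𝔡(H)`; `Θ_H ∈ 𝔥(H)_ℂ`; the trace functionals
  `Z ↦ tr((π_i Z ι_i) φ_i)` kill `𝔡(H)_ℂ` and read `(λ x₀ tr φ₁², λ y₀ tr φ₂²)` on `ℂ z₀`).  («If `Hg(X) ≠ Hg(X₁) × Hg(X₂)` then the center of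
  `Hg(X₁)` contains an algebraic torus `ℚ`-isogenous to `Hg(X₂)`»: the rationality of `c = y₀/x₀` is the Lie shadow of «`ℚ`-isogenous».)
* §5 under NON-RESONANCE `hres : ∀ c : ℚ, tr(φ₁²)·tr(Θ₂ φ₂,ℂ) ≠ c·tr(Θ₁ φ₁,ℂ)·tr(φ₂²)` (the hypothesis (NONRES) of
  `HodgeThetaAnnihilatorTimesRankOneTorus`, verbatim): **`incl_comp_proj_mem_hodgeLie_of_traceSlopes`** (`ι₂ φ₂ π₂ ∈ 𝔥(H)`),
  **`corner_mem_of_cmCurve_summand`** (`𝔥(H)` contains the first corners of its elements), **`exists_linearEquiv_prod_and_finrank_hodgeLie_eq_add_of_cmCurve_summand`**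
  (`𝔥(H₁) × 𝔥(H₂) ≅ 𝔥(H)` by the block map and `dim 𝔥(H) = dim 𝔥(H₁) + dim 𝔥(H₂)`, via `exists_linearEquiv_prod_hodgeLie_of_corner_mem`:
  «`Hg(X × E) = Hg(X) × Hg(E)`»).
For `V₁ = H¹(T)`, `T` a simple abelian threefold with `End⁰T = ℚ(√-d₁)` (multiplicities `(2,1)`), (NONRES) says `d₁/d₂ ∉ (ℚ^×)²`
(`HodgeTheory/RankOneCentreTimesCMCurveInvariance`); AV reading: `CorCM/MumfordTateRankTimesCMCurve` (`dim MT(H¹(T × E)) = 11`).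

## References
* [MoonenZarhin1999LowDim] B. Moonen, Yu. G. Zarhin, *Hodge classes on abelian varieties of low dimension*, Math. Ann. 315 (1999), §3 (3.1),
  Lemma (3.6), Prop. (3.8), Thm. 0.1 (4) [corpus: paper:arxiv-math_9901113 pp. 1, 6–7]. [cite: MoonenZarhin1999LowDim, §3 Lemma (3.6) and Prop. (3.8)]
* [Deligne1982HodgeCycles] P. Deligne, *Hodge cycles on abelian varieties*, LNM 900 (1982), I §3 Prop. 3.4 and Prop. 3.6 (`Hg` reductive).
  [cite: Deligne1982HodgeCycles, I §3 Prop. 3.6]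
* [Humphreys1972] J. E. Humphreys, GTM 9, §5.1, §19.1 (`L = Z(L) ⊕ [L, L]`). [cite: Humphreys1972, §19.1]
-/

noncomputable section

open scoped TensorProduct

namespace Literature.AlgebraicGeometry.Motives

namespace HodgeStructure

universe u

variable {V₁ : Type u} [AddCommGroup V₁] [Module ℚ V₁] [Module.Finite ℚ V₁]
  {V₂ : Type u} [AddCommGroup V₂] [Module ℚ V₂] [Module.Finite ℚ V₂]
  {V : Type u} [AddCommGroup V] [Module ℚ V] [Module.Finite ℚ V] [HodgeTensorFacts.{u, u}] {n : ℤ}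
  {H₁ : HodgeStructure V₁ n} {H₂ : HodgeStructure V₂ n} {H : HodgeStructure V n}
  (ι₁ : Hom H₁ H) (π₁ : Hom H H₁) (ι₂ : Hom H₂ H) (π₂ : Hom H H₂)
  (hπι₁ : ∀ v, π₁.toLinearMap (ι₁.toLinearMap v) = v) (hπι₂ : ∀ v, π₂.toLinearMap (ι₂.toLinearMap v) = v)
  (hsum : ∀ v, ι₁.toLinearMap (π₁.toLinearMap v) + ι₂.toLinearMap (π₂.toLinearMap v) = v)
  (hn : n = 1) (heff₂ : H₂.IsEffective) (ψ : H.Polarization) (ψ₁ : H₁.Polarization) (ψ₂ : H₂.Polarization)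
  {φ₁ : Module.End ℚ V₁} (hφ₁E : φ₁ ∈ H₁.endAlg)
  (hZ₁ : ∀ a ∈ H₁.endAlg, (∀ b ∈ H₁.endAlg, a * b = b * a) →
    (∀ v w, ψ₁.form (a v) w + ψ₁.form v (a w) = 0) → ∃ x : ℚ, a = x • φ₁)
  {φ₂ : Module.End ℚ V₂} (hφ₂E : φ₂ ∈ H₂.endAlg) {d₂ : ℚ} (hd₂ : 0 < d₂) (hφ₂ : φ₂ * φ₂ = -(d₂ • 1))
  (hV₂ : Module.finrank ℚ V₂ = 2)

/-! ## §1 Slot and base-change plumbing -/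

omit [Module.Finite ℚ V₁] [Module.Finite ℚ V₂] [Module.Finite ℚ V] [HodgeTensorFacts.{u, u}] in
include hπι₁ hπι₂ hsum in
/-- `π₂ ι₁ = 0` for a decomposition `ι₁ π₁ + ι₂ π₂ = id` with `π_i ι_i = id`. [folklore] -/
private theorem proj₂_incl₁_eq_zero_cm (v : V₁) : π₂.toLinearMap (ι₁.toLinearMap v) = 0 := by
  have h := congrArg π₂.toLinearMap (hsum (ι₁.toLinearMap v))
  rw [map_add, hπι₁ v, hπι₂] at h
  exact add_eq_left.1 h

omit [Module.Finite ℚ V₁] [Module.Finite ℚ V₂] [Module.Finite ℚ V] [HodgeTensorFacts.{u, u}] in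
include hπι₁ hπι₂ hsum in
/-- `π₁ ι₂ = 0` for a decomposition `ι₁ π₁ + ι₂ π₂ = id` with `π_i ι_i = id`. [folklore] -/
private theorem proj₁_incl₂_eq_zero_cm (v : V₂) : π₁.toLinearMap (ι₂.toLinearMap v) = 0 := by
  have h := congrArg π₁.toLinearMap (hsum (ι₂.toLinearMap v))
  rw [map_add, hπι₂ v, hπι₁] at h
  exact add_eq_left.1 h

omit [Module.Finite ℚ V] [HodgeTensorFacts.{u, u}] in
/-- Base change of a rational multiple: `(c • T)_ℂ = c • T_ℂ`. [folklore] -/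
private theorem baseChange_ratCast_smul_cm (c : ℚ) (T : Module.End ℚ V) :
    (c • T).baseChange ℂ = (c : ℂ) • T.baseChange ℂ := by
  refine TensorProduct.AlgebraTensorModule.ext fun z v => ?_
  rw [LinearMap.baseChange_tmul, LinearMap.smul_apply, LinearMap.smul_apply, LinearMap.baseChange_tmul,
    TensorProduct.smul_tmul', ← TensorProduct.smul_tmul, Rat.smul_def, smul_eq_mul]

omit [Module.Finite ℚ V] [HodgeTensorFacts.{u, u}] in
/-- `(𝔞 ⊔ 𝔟)_ℂ ≤ 𝔞_ℂ ⊔ 𝔟_ℂ` for the complex spans. [folklore] -/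
private theorem spanC_sup_le (𝔞 𝔟 : Submodule ℚ (Module.End ℚ V)) : spanC (𝔞 ⊔ 𝔟) ≤ spanC 𝔞 ⊔ spanC 𝔟 := by
  change Submodule.span ℂ _ ≤ _
  rw [Submodule.span_le]
  rintro _ ⟨X, hX, rfl⟩
  obtain ⟨a, ha, b, hb, rfl⟩ := Submodule.mem_sup.1 hX
  change (a + b).baseChange ℂ ∈ spanC 𝔞 ⊔ spanC 𝔟
  rw [LinearMap.baseChange_add]
  exact Submodule.add_mem _ (Submodule.mem_sup_left (baseChange_mem_spanC ha))
    (Submodule.mem_sup_right (baseChange_mem_spanC hb))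

omit [Module.Finite ℚ V] [HodgeTensorFacts.{u, u}] in
/-- `(ℚ z)_ℂ ≤ ℂ z_ℂ`. [folklore] -/
private theorem spanC_span_singleton_le (z : Module.End ℚ V) : spanC (ℚ ∙ z) ≤ ℂ ∙ z.baseChange ℂ := by
  change Submodule.span ℂ _ ≤ _
  rw [Submodule.span_le]
  rintro _ ⟨X, hX, rfl⟩
  obtain ⟨q, rfl⟩ := Submodule.mem_span_singleton.1 hX
  change (q • z).baseChange ℂ ∈ ℂ ∙ z.baseChange ℂ
  rw [baseChange_ratCast_smul_cm]
  exact Submodule.smul_mem _ _ (Submodule.mem_span_singleton_self _)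

/-! ## §2 The CM-curve summand: `π₂ 𝔥(H) ι₂ ⊆ ℚφ₂`, brackets have zero `V₂`-block and `φ₁`-trace-free `V₁`-block -/

include hπι₂ hn heff₂ ψ₂ hφ₂E hd₂ hφ₂ hV₂ in
/-- **`π₂ X ι₂ ∈ ℚφ₂` for `X ∈ 𝔥(H)`**: the block `π₂ X ι₂` lies in `𝔥(H₂)` (`comp_mem_hodgeLie_of_retract`), so it is `ψ₂`-skew and
commutes with the Hodge endomorphism `φ₂`; in rank two with `φ₂² = -d₂ < 0` such an operator is a rational multiple of `φ₂`
(`RankTwoCM.exists_eq_ratCast_smul_of_commute_of_skew`: «`Lie Hg(E) = 𝔲_k = ℚφ₂`»). [cite: MoonenZarhin1999LowDim, §2 (2.1) and §3 Prop. (3.8)] -/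
theorem exists_restrict₂_eq_smul_of_cmCurve {X : Module.End ℚ V} (hX : X ∈ H.hodgeLie) :
    ∃ c : ℚ, π₂.toLinearMap ∘ₗ X ∘ₗ ι₂.toLinearMap = c • φ₂ := by
  have hX₂ : π₂.toLinearMap ∘ₗ X ∘ₗ ι₂.toLinearMap ∈ H₂.hodgeLie := comp_mem_hodgeLie_of_retract ι₂ π₂ hπι₂ hX
  exact RankTwoCM.exists_eq_ratCast_smul_of_commute_of_skew H₂ hn heff₂ hV₂ ψ₂ hφ₂E hd₂ hφ₂
    (commute_of_mem_hodgeLie H₂ hX₂ ⟨φ₂, hφ₂E⟩) (form_apply_add_eq_zero_of_mem_hodgeLie ψ₂ hX₂)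

include hπι₂ hn heff₂ ψ₂ hφ₂E hd₂ hφ₂ hV₂ in
/-- **Brackets of `𝔥(H)` have zero `V₂`-block**: `π₂ (XY - YX) ι₂ = (π₂Xι₂)(π₂Yι₂) - (π₂Yι₂)(π₂Xι₂) = 0`, both blocks being multiples of `φ₂`
(`restrict_mul`). (`Hg(E)` is a torus: the derived algebra of `𝔥(H)` is supported on `V₁`.) [cite: MoonenZarhin1999LowDim, §3 Lemma (3.6)] -/
theorem restrict₂_commutator_eq_zero_of_cmCurve {X Y : Module.End ℚ V} (hX : X ∈ H.hodgeLie) (hY : Y ∈ H.hodgeLie) :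
    π₂.toLinearMap ∘ₗ (X * Y - Y * X) ∘ₗ ι₂.toLinearMap = 0 := by
  obtain ⟨a, ha⟩ := exists_restrict₂_eq_smul_of_cmCurve ι₂ π₂ hπι₂ hn heff₂ ψ₂ hφ₂E hd₂ hφ₂ hV₂ hX
  obtain ⟨b, hb⟩ := exists_restrict₂_eq_smul_of_cmCurve ι₂ π₂ hπι₂ hn heff₂ ψ₂ hφ₂E hd₂ hφ₂ hV₂ hY
  have h : π₂.toLinearMap ∘ₗ (X * Y - Y * X) ∘ₗ ι₂.toLinearMap =
      π₂.toLinearMap ∘ₗ (X * Y) ∘ₗ ι₂.toLinearMap - π₂.toLinearMap ∘ₗ (Y * X) ∘ₗ ι₂.toLinearMap := by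
    rw [LinearMap.sub_comp, LinearMap.comp_sub]
  rw [h, restrict_mul ι₂ π₂ hπι₂ hY, restrict_mul ι₂ π₂ hπι₂ hX, ha, hb, smul_mul_smul_comm, smul_mul_smul_comm,
    mul_comm b a, sub_self]

include hπι₁ hφ₁E in
/-- **The `V₁`-block of a bracket of `𝔥(H)` is `φ₁`-trace-free**: `tr((π₁ (XY - YX) ι₁) φ₁) = tr((AB - BA) φ₁) = 0` for `A = π₁Xι₁`,
`B = π₁Yι₁ ∈ 𝔥(H₁)`, which commute with the Hodge endomorphism `φ₁` (cyclicity of the trace: `tr(BAφ₁) = tr(Bφ₁A) = tr(ABφ₁)`).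
[cite: Humphreys1972, §5.1] [cite: Deligne1982HodgeCycles, I §3 Prop. 3.6] -/
theorem trace_restrict₁_commutator_mul_eq_zero {X Y : Module.End ℚ V} (hX : X ∈ H.hodgeLie) (hY : Y ∈ H.hodgeLie) :
    LinearMap.trace ℚ V₁ ((π₁.toLinearMap ∘ₗ (X * Y - Y * X) ∘ₗ ι₁.toLinearMap) * φ₁) = 0 := by
  set A := π₁.toLinearMap ∘ₗ X ∘ₗ ι₁.toLinearMap with hA
  set B := π₁.toLinearMap ∘ₗ Y ∘ₗ ι₁.toLinearMap with hB
  have hAφ : A * φ₁ = φ₁ * A := commute_of_mem_hodgeLie H₁ (comp_mem_hodgeLie_of_retract ι₁ π₁ hπι₁ hX) ⟨φ₁, hφ₁E⟩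
  have h : π₁.toLinearMap ∘ₗ (X * Y - Y * X) ∘ₗ ι₁.toLinearMap = A * B - B * A := by
    rw [LinearMap.sub_comp, LinearMap.comp_sub, restrict_mul ι₁ π₁ hπι₁ hY, restrict_mul ι₁ π₁ hπι₁ hX]
  rw [h, sub_mul, map_sub, mul_assoc B A φ₁, hAφ, ← mul_assoc, LinearMap.trace_mul_comm ℚ (B * φ₁) A, ← mul_assoc, sub_self]

/-! ## §3 The centre `𝔷(H) = 𝔥(H) ∩ End_Hdg(H)`: blocks `(x φ₁, y φ₂)` and the dichotomy -/

include hπι₁ hπι₂ hn heff₂ ψ₁ ψ₂ hZ₁ hφ₂E hd₂ hφ₂ hV₂ in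
/-- **An element of the centre `𝔷(H) = 𝔥(H) ∩ End_Hdg(H)` has blocks `π₁ z ι₁ = x φ₁`, `π₂ z ι₂ = y φ₂` with `x, y ∈ ℚ`**: the first block is
a Hodge endomorphism of `H₁` (composite of morphisms), lies in `𝔥(H₁)`, hence is `ψ₁`-skew and commutes with `End_Hdg(H₁)` — so it is in
`ℚφ₁` by the hypothesis on the skew centre; the second block lies in `ℚφ₂` (§2).  («The centre of `Hg(X₁ × X₂)` lies in
`Z(Hg X₁) × Hg(X₂) ⊆ U_{k'} × U_k`».) [cite: MoonenZarhin1999LowDim, §3 Lemma (3.6)] [cite: Deligne1982HodgeCycles, I §3 Prop. 3.6] -/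
theorem exists_center_blocks_of_cmCurve {z : Module.End ℚ V} (hz : z ∈ H.hodgeLie ⊓ Subalgebra.toSubmodule H.endAlg) :
    ∃ x y : ℚ, π₁.toLinearMap ∘ₗ z ∘ₗ ι₁.toLinearMap = x • φ₁ ∧ π₂.toLinearMap ∘ₗ z ∘ₗ ι₂.toLinearMap = y • φ₂ := by
  obtain ⟨hz𝔥, hzE⟩ := Submodule.mem_inf.1 hz
  rw [Subalgebra.mem_toSubmodule] at hzE
  have hz₁𝔥 : π₁.toLinearMap ∘ₗ z ∘ₗ ι₁.toLinearMap ∈ H₁.hodgeLie := comp_mem_hodgeLie_of_retract ι₁ π₁ hπι₁ hz𝔥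
  have hz₁E : π₁.toLinearMap ∘ₗ z ∘ₗ ι₁.toLinearMap ∈ H₁.endAlg :=
    ((π₁.comp (endAlg.toHom ⟨z, hzE⟩)).comp ι₁).toLinearMap_mem_endAlg
  obtain ⟨x, hx⟩ := hZ₁ _ hz₁E (fun b hb => commute_of_mem_hodgeLie H₁ hz₁𝔥 ⟨b, hb⟩)
    (form_apply_add_eq_zero_of_mem_hodgeLie ψ₁ hz₁𝔥)
  obtain ⟨y, hy⟩ := exists_restrict₂_eq_smul_of_cmCurve ι₂ π₂ hπι₂ hn heff₂ ψ₂ hφ₂E hd₂ hφ₂ hV₂ hz𝔥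
  exact ⟨x, y, hx, hy⟩

include hπι₁ hπι₂ hsum hn heff₂ ψ₁ ψ₂ hZ₁ hφ₂E hd₂ hφ₂ hV₂ in
/-- **Dichotomy on the centre.**  EITHER `ι₂ φ₂ π₂ ∈ 𝔥(H)` (some central `z` has blocks `(0, yφ₂)` with `y ≠ 0`, and `z = ι₂ (yφ₂) π₂`), OR there
is `z₀ ∈ 𝔷(H)` with blocks `(x₀ φ₁, y₀ φ₂)`, `x₀ ≠ 0` or `z₀ = 0`, such that `𝔷(H) ⊆ ℚ z₀` (for `z ∈ 𝔷(H)` with first block `x φ₁`,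
`z - (x/x₀) z₀` is central with zero first block, hence zero second block, hence zero — `eq_sum_blocks_of_mem_hodgeLie`).  The centre of
`Hg(X × E)` is a torus of rank `≤ 1` over `ℚ(z₀)` unless it contains `Hg(E)`. [cite: MoonenZarhin1999LowDim, §3 Lemma (3.6)] -/
theorem center_dichotomy_of_cmCurve :
    ι₂.toLinearMap ∘ₗ φ₂ ∘ₗ π₂.toLinearMap ∈ H.hodgeLie ∨
      ∃ z₀ ∈ H.hodgeLie ⊓ Subalgebra.toSubmodule H.endAlg, ∃ x₀ y₀ : ℚ,
        π₁.toLinearMap ∘ₗ z₀ ∘ₗ ι₁.toLinearMap = x₀ • φ₁ ∧ π₂.toLinearMap ∘ₗ z₀ ∘ₗ ι₂.toLinearMap = y₀ • φ₂ ∧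
        (x₀ ≠ 0 ∨ z₀ = 0) ∧ H.hodgeLie ⊓ Subalgebra.toSubmodule H.endAlg ≤ ℚ ∙ z₀ := by
  set 𝔷 := H.hodgeLie ⊓ Subalgebra.toSubmodule H.endAlg with h𝔷
  -- blocks of central elements
  have hblocks : ∀ z ∈ 𝔷, z = ι₁.toLinearMap ∘ₗ (π₁.toLinearMap ∘ₗ z ∘ₗ ι₁.toLinearMap) ∘ₗ π₁.toLinearMap +
      ι₂.toLinearMap ∘ₗ (π₂.toLinearMap ∘ₗ z ∘ₗ ι₂.toLinearMap) ∘ₗ π₂.toLinearMap := fun z hz =>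
    eq_sum_blocks_of_mem_hodgeLie ι₁ π₁ ι₂ π₂ hπι₁ hπι₂ hsum (Submodule.mem_inf.1 hz).1
  by_cases hex : ∃ z ∈ 𝔷, π₁.toLinearMap ∘ₗ z ∘ₗ ι₁.toLinearMap = 0 ∧ π₂.toLinearMap ∘ₗ z ∘ₗ ι₂.toLinearMap ≠ 0
  · -- a central element supported on `V₂`: `z = ι₂ (y φ₂) π₂`, `y ≠ 0`
    left
    obtain ⟨z, hz, hz₁, hz₂⟩ := hex
    obtain ⟨x, y, -, hy⟩ := exists_center_blocks_of_cmCurve ι₁ π₁ ι₂ π₂ hπι₁ hπι₂ hn heff₂ ψ₁ ψ₂ hZ₁ hφ₂E hd₂ hφ₂ hV₂ hz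
    have hy0 : y ≠ 0 := by
      rintro rfl
      rw [zero_smul] at hy
      exact hz₂ hy
    have hzeq : z = y • (ι₂.toLinearMap ∘ₗ φ₂ ∘ₗ π₂.toLinearMap) := by
      conv_lhs => rw [hblocks z hz, hz₁, hy]
      rw [LinearMap.zero_comp, LinearMap.comp_zero, zero_add, LinearMap.smul_comp, LinearMap.comp_smul]
    have hmem : y⁻¹ • z ∈ H.hodgeLie := Submodule.smul_mem _ _ (Submodule.mem_inf.1 hz).1
    rw [hzeq, smul_smul, inv_mul_cancel₀ hy0, one_smul] at hmem
    exact hmem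
  · right
    push Not at hex
    by_cases hall : ∀ z ∈ 𝔷, π₁.toLinearMap ∘ₗ z ∘ₗ ι₁.toLinearMap = 0
    · -- the centre vanishes
      refine ⟨0, Submodule.zero_mem _, 0, 0, ?_, ?_, Or.inr rfl, fun z hz => ?_⟩
      · rw [LinearMap.zero_comp, LinearMap.comp_zero, zero_smul]
      · rw [LinearMap.zero_comp, LinearMap.comp_zero, zero_smul]
      · have h1 := hall z hz
        have h2 := hex z hz h1
        have hz0 : z = 0 := by
          rw [hblocks z hz, h1, h2, LinearMap.zero_comp, LinearMap.comp_zero, LinearMap.zero_comp, LinearMap.comp_zero, add_zero]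
        rw [hz0]
        exact Submodule.zero_mem _
    · push Not at hall
      obtain ⟨z₀, hz₀, hz₀1⟩ := hall
      obtain ⟨x₀, y₀, hx₀, hy₀⟩ := exists_center_blocks_of_cmCurve ι₁ π₁ ι₂ π₂ hπι₁ hπι₂ hn heff₂ ψ₁ ψ₂ hZ₁ hφ₂E hd₂ hφ₂ hV₂ hz₀
      have hx₀0 : x₀ ≠ 0 := by
        rintro rfl
        rw [zero_smul] at hx₀
        exact hz₀1 hx₀
      refine ⟨z₀, hz₀, x₀, y₀, hx₀, hy₀, Or.inl hx₀0, fun z hz => ?_⟩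
      obtain ⟨x, y, hx, -⟩ := exists_center_blocks_of_cmCurve ι₁ π₁ ι₂ π₂ hπι₁ hπι₂ hn heff₂ ψ₁ ψ₂ hZ₁ hφ₂E hd₂ hφ₂ hV₂ hz
      -- `z - (x/x₀) z₀` is central with zero first block
      have hz' : z - (x / x₀) • z₀ ∈ 𝔷 := Submodule.sub_mem _ hz (Submodule.smul_mem _ _ hz₀)
      have hz'1 : π₁.toLinearMap ∘ₗ (z - (x / x₀) • z₀) ∘ₗ ι₁.toLinearMap = 0 := by
        rw [LinearMap.sub_comp, LinearMap.comp_sub, LinearMap.smul_comp, LinearMap.comp_smul, hx, hx₀, smul_smul,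
          div_mul_cancel₀ x hx₀0, sub_self]
      have hz'2 := hex _ hz' hz'1
      have hz'0 : z - (x / x₀) • z₀ = 0 := by
        rw [hblocks _ hz', hz'1, hz'2, LinearMap.zero_comp, LinearMap.comp_zero, LinearMap.zero_comp, LinearMap.comp_zero, add_zero]
      rw [sub_eq_zero] at hz'0
      rw [hz'0]
      exact Submodule.smul_mem _ _ (Submodule.mem_span_singleton_self _)

/-! ## §4 The dichotomy: `ι₂ φ₂ π₂ ∈ 𝔥(H)`, or the `Θ`-trace slopes resonate with a rational ratio -/

section Theta

variable {Θ₁ : Module.End ℂ (ℂ ⊗[ℚ] V₁)} (hΘ₁ : ∀ p, ∀ x ∈ H₁.piece p (n - p), Θ₁ x = ((2 * p - n : ℤ) : ℂ) • x)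
  {Θ₂ : Module.End ℂ (ℂ ⊗[ℚ] V₂)} (hΘ₂ : ∀ p, ∀ x ∈ H₂.piece p (n - p), Θ₂ x = ((2 * p - n : ℤ) : ℂ) • x)

include hπι₁ hπι₂ hn heff₂ ψ ψ₂ hφ₁E hφ₂E hd₂ hφ₂ hV₂ hΘ₁ hΘ₂ in
/-- **The trace identities along `ℂ z₀ ⊕ 𝔡(H)_ℂ`.**  If `𝔷(H) ⊆ ℚ z₀` with blocks `(x₀ φ₁, y₀ φ₂)` of `z₀`, then for some `λ ∈ ℂ`:
`tr(Θ₁ φ₁,ℂ) = λ x₀ tr(φ₁²)` and `tr(Θ₂ φ₂,ℂ) = λ y₀ tr(φ₂²)`.  Indeed `Θ_H ∈ 𝔥(H)_ℂ = (𝔷(H) ⊕ 𝔡(H))_ℂ ⊆ ℂ z₀,ℂ + 𝔡(H)_ℂ` (Deligne: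
`𝔥 = 𝔷 ⊕ 𝔡`, `hodgeLie_center_sup_derived_eq`), `Θ_H = λ z₀,ℂ + s`; the `ℂ`-linear functionals `Z ↦ tr((π_i,ℂ Z ι_i,ℂ) φ_i,ℂ)` send `Θ_H` to
`tr(Θ_i φ_i,ℂ)` (`π_i,ℂ Θ_H ι_i,ℂ = Θ_i`), kill `𝔡(H)_ℂ` (§2) and send `z₀,ℂ` to `x₀ tr(φ₁²)`, `y₀ tr(φ₂²)`.
[cite: Deligne1982HodgeCycles, I §3 Prop. 3.6] [cite: MoonenZarhin1999LowDim, §3 Lemma (3.6)] -/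
theorem exists_traces_eq_of_center_le_span {z₀ : Module.End ℚ V} {x₀ y₀ : ℚ}
    (hx₀ : π₁.toLinearMap ∘ₗ z₀ ∘ₗ ι₁.toLinearMap = x₀ • φ₁) (hy₀ : π₂.toLinearMap ∘ₗ z₀ ∘ₗ ι₂.toLinearMap = y₀ • φ₂)
    (hle : H.hodgeLie ⊓ Subalgebra.toSubmodule H.endAlg ≤ ℚ ∙ z₀) :
    ∃ lam : ℂ, LinearMap.trace ℂ _ (Θ₁ * φ₁.baseChange ℂ) = lam * x₀ * ((LinearMap.trace ℚ V₁ (φ₁ * φ₁) : ℚ) : ℂ) ∧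
      LinearMap.trace ℂ _ (Θ₂ * φ₂.baseChange ℂ) = lam * y₀ * ((LinearMap.trace ℚ V₂ (φ₂ * φ₂) : ℚ) : ℂ) := by
  classical
  -- `Θ_H` and the presentation
  obtain ⟨ΘU, hΘU⟩ := exists_hodgeTheta H
  have hπι₁' : π₁.toLinearMap ∘ₗ ι₁.toLinearMap = LinearMap.id := LinearMap.ext hπι₁
  have hπι₂' : π₂.toLinearMap ∘ₗ ι₂.toLinearMap = LinearMap.id := LinearMap.ext hπι₂
  have hι₁F : ∀ p, ∀ x ∈ H₁.piece p (n - p), ι₁.toLinearMap.baseChange ℂ x ∈ H.piece p (n - p) :=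
    fun p x hx => ι₁.map_piece_le p _ ⟨x, hx, rfl⟩
  have hι₂F : ∀ p, ∀ x ∈ H₂.piece p (n - p), ι₂.toLinearMap.baseChange ℂ x ∈ H.piece p (n - p) :=
    fun p x hx => ι₂.map_piece_le p _ ⟨x, hx, rfl⟩
  have hΘι₁ := theta_incl_eq H H₁ hι₁F hΘU hΘ₁
  have hΘι₂ := theta_incl_eq H H₂ hι₂F hΘU hΘ₂
  have hrΘ₁ : π₁.toLinearMap.baseChange ℂ ∘ₗ ΘU ∘ₗ ι₁.toLinearMap.baseChange ℂ = Θ₁ := by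
    refine LinearMap.ext fun x => ?_
    rw [LinearMap.comp_apply, LinearMap.comp_apply, hΘι₁, proj_incl_baseChange hπι₁']
  have hrΘ₂ : π₂.toLinearMap.baseChange ℂ ∘ₗ ΘU ∘ₗ ι₂.toLinearMap.baseChange ℂ = Θ₂ := by
    refine LinearMap.ext fun x => ?_
    rw [LinearMap.comp_apply, LinearMap.comp_apply, hΘι₂, proj_incl_baseChange hπι₂']
  -- the two `ℂ`-linear trace functionals
  let r₁ : Module.End ℂ (ℂ ⊗[ℚ] V) →ₗ[ℂ] Module.End ℂ (ℂ ⊗[ℚ] V₁) :=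
    (LinearMap.llcomp ℂ _ _ _ (π₁.toLinearMap.baseChange ℂ)).comp (LinearMap.lcomp ℂ _ (ι₁.toLinearMap.baseChange ℂ))
  let r₂ : Module.End ℂ (ℂ ⊗[ℚ] V) →ₗ[ℂ] Module.End ℂ (ℂ ⊗[ℚ] V₂) :=
    (LinearMap.llcomp ℂ _ _ _ (π₂.toLinearMap.baseChange ℂ)).comp (LinearMap.lcomp ℂ _ (ι₂.toLinearMap.baseChange ℂ))
  have hr₁ : ∀ Z, r₁ Z = π₁.toLinearMap.baseChange ℂ ∘ₗ Z ∘ₗ ι₁.toLinearMap.baseChange ℂ := fun Z => rfl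
  have hr₂ : ∀ Z, r₂ Z = π₂.toLinearMap.baseChange ℂ ∘ₗ Z ∘ₗ ι₂.toLinearMap.baseChange ℂ := fun Z => rfl
  let ℓ₁ : Module.End ℂ (ℂ ⊗[ℚ] V) →ₗ[ℂ] ℂ := (LinearMap.trace ℂ _).comp ((LinearMap.mulRight ℂ (φ₁.baseChange ℂ)).comp r₁)
  let ℓ₂ : Module.End ℂ (ℂ ⊗[ℚ] V) →ₗ[ℂ] ℂ := (LinearMap.trace ℂ _).comp ((LinearMap.mulRight ℂ (φ₂.baseChange ℂ)).comp r₂)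
  have hℓ₁ : ∀ Z, ℓ₁ Z = LinearMap.trace ℂ _ ((π₁.toLinearMap.baseChange ℂ ∘ₗ Z ∘ₗ ι₁.toLinearMap.baseChange ℂ) * φ₁.baseChange ℂ) :=
    fun Z => rfl
  have hℓ₂ : ∀ Z, ℓ₂ Z = LinearMap.trace ℂ _ ((π₂.toLinearMap.baseChange ℂ ∘ₗ Z ∘ₗ ι₂.toLinearMap.baseChange ℂ) * φ₂.baseChange ℂ) :=
    fun Z => rfl
  -- values on rational operators
  have hℓ₁Q : ∀ X : Module.End ℚ V, ℓ₁ (X.baseChange ℂ) =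
      ((LinearMap.trace ℚ V₁ ((π₁.toLinearMap ∘ₗ X ∘ₗ ι₁.toLinearMap) * φ₁) : ℚ) : ℂ) := fun X => by
    rw [hℓ₁, ← LinearMap.baseChange_comp, ← LinearMap.baseChange_comp, ← LinearMap.baseChange_mul, LinearMap.trace_baseChange,
      eq_ratCast]
  have hℓ₂Q : ∀ X : Module.End ℚ V, ℓ₂ (X.baseChange ℂ) =
      ((LinearMap.trace ℚ V₂ ((π₂.toLinearMap ∘ₗ X ∘ₗ ι₂.toLinearMap) * φ₂) : ℚ) : ℂ) := fun X => by
    rw [hℓ₂, ← LinearMap.baseChange_comp, ← LinearMap.baseChange_comp, ← LinearMap.baseChange_mul, LinearMap.trace_baseChange,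
      eq_ratCast]
  -- both functionals kill `𝔡(H)_ℂ`
  set 𝔡 : Submodule ℚ (Module.End ℚ V) := Submodule.span ℚ {B | ∃ X ∈ H.hodgeLie, ∃ Y ∈ H.hodgeLie, X * Y - Y * X = B} with h𝔡
  have h𝔡ℓ₁ : ∀ B ∈ 𝔡, LinearMap.trace ℚ V₁ ((π₁.toLinearMap ∘ₗ B ∘ₗ ι₁.toLinearMap) * φ₁) = 0 := by
    intro B hB
    induction hB using Submodule.span_induction with
    | mem B hB =>
      obtain ⟨X, hX, Y, hY, rfl⟩ := hB
      exact trace_restrict₁_commutator_mul_eq_zero ι₁ π₁ hπι₁ hφ₁E hX hY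
    | zero => rw [LinearMap.zero_comp, LinearMap.comp_zero, zero_mul, map_zero]
    | add B B' _ _ hB hB' => rw [LinearMap.add_comp, LinearMap.comp_add, add_mul, map_add, hB, hB', add_zero]
    | smul c B _ hB => rw [LinearMap.smul_comp, LinearMap.comp_smul, smul_mul_assoc, map_smul, hB, smul_zero]
  have h𝔡ℓ₂ : ∀ B ∈ 𝔡, LinearMap.trace ℚ V₂ ((π₂.toLinearMap ∘ₗ B ∘ₗ ι₂.toLinearMap) * φ₂) = 0 := by
    intro B hB
    induction hB using Submodule.span_induction with
    | mem B hB =>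
      obtain ⟨X, hX, Y, hY, rfl⟩ := hB
      rw [restrict₂_commutator_eq_zero_of_cmCurve ι₂ π₂ hπι₂ hn heff₂ ψ₂ hφ₂E hd₂ hφ₂ hV₂ hX hY, zero_mul, map_zero]
    | zero => rw [LinearMap.zero_comp, LinearMap.comp_zero, zero_mul, map_zero]
    | add B B' _ _ hB hB' => rw [LinearMap.add_comp, LinearMap.comp_add, add_mul, map_add, hB, hB', add_zero]
    | smul c B _ hB => rw [LinearMap.smul_comp, LinearMap.comp_smul, smul_mul_assoc, map_smul, hB, smul_zero]
  have hCℓ₁ : ∀ s ∈ spanC 𝔡, ℓ₁ s = 0 := by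
    intro s hs
    change s ∈ Submodule.span ℂ _ at hs
    induction hs using Submodule.span_induction with
    | mem s hs =>
      obtain ⟨B, hB, rfl⟩ := hs
      rw [hℓ₁Q, h𝔡ℓ₁ B hB, Rat.cast_zero]
    | zero => exact map_zero ℓ₁
    | add s s' _ _ hs hs' => rw [map_add, hs, hs', add_zero]
    | smul c s _ hs => rw [map_smul, hs, smul_zero]
  have hCℓ₂ : ∀ s ∈ spanC 𝔡, ℓ₂ s = 0 := by
    intro s hs
    change s ∈ Submodule.span ℂ _ at hs
    induction hs using Submodule.span_induction with
    | mem s hs =>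
      obtain ⟨B, hB, rfl⟩ := hs
      rw [hℓ₂Q, h𝔡ℓ₂ B hB, Rat.cast_zero]
    | zero => exact map_zero ℓ₂
    | add s s' _ _ hs hs' => rw [map_add, hs, hs', add_zero]
    | smul c s _ hs => rw [map_smul, hs, smul_zero]
  -- `Θ_H = λ z₀,ℂ + s`
  have hΘ𝔥 : ΘU ∈ spanC H.hodgeLie := (hodgeLieC_eq_spanC H) ▸ H.mem_hodgeLieC_of_forall_piece hΘU
  have h𝔥le : H.hodgeLie ≤ (ℚ ∙ z₀) ⊔ 𝔡 := by
    rw [← AnyWeight.hodgeLie_center_sup_derived_eq H ψ]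
    exact sup_le_sup_right hle _
  have hΘmem : ΘU ∈ (ℂ ∙ z₀.baseChange ℂ) ⊔ spanC 𝔡 :=
    (sup_le_sup_right (spanC_span_singleton_le z₀) _) (spanC_sup_le _ _ (spanC_mono h𝔥le hΘ𝔥))
  obtain ⟨a, ha, s, hs, has⟩ := Submodule.mem_sup.1 hΘmem
  obtain ⟨lam, rfl⟩ := Submodule.mem_span_singleton.1 ha
  refine ⟨lam, ?_, ?_⟩
  · have h := congrArg ℓ₁ has
    rw [map_add, map_smul, hCℓ₁ s hs, add_zero, hℓ₁Q, hx₀, smul_mul_assoc, map_smul, smul_eq_mul, smul_eq_mul,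
      Rat.cast_mul, hℓ₁, hrΘ₁] at h
    rw [← h]
    ring
  · have h := congrArg ℓ₂ has
    rw [map_add, map_smul, hCℓ₂ s hs, add_zero, hℓ₂Q, hy₀, smul_mul_assoc, map_smul, smul_eq_mul, smul_eq_mul,
      Rat.cast_mul, hℓ₂, hrΘ₂] at h
    rw [← h]
    ring

include hπι₁ hπι₂ hsum hn heff₂ ψ ψ₁ ψ₂ hφ₁E hZ₁ hφ₂E hd₂ hφ₂ hV₂ hΘ₁ hΘ₂ in
/-- **Moonen–Zarhin Lemma (3.6) for `𝔥(H)`, as a dichotomy.**  For `H ≅ H₁ ⊕ H₂` of weight one with `H₂` the `H¹` of a CM elliptic curve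
(`dim V₂ = 2`, `φ₂² = -d₂ < 0`) and `H₁` with `ψ₁`-skew centre of `End_Hdg(H₁)` inside `ℚφ₁`: EITHER `ι₂ φ₂ π₂ ∈ 𝔥(H)` (then
`𝔥(H) = 𝔥(H₁) × 𝔥(H₂)`, §5), OR the `Θ`-trace slopes resonate with a RATIONAL ratio,
`tr(φ₁²)·tr(Θ₂ φ₂,ℂ) = c·tr(Θ₁ φ₁,ℂ)·tr(φ₂²)`, `c ∈ ℚ` («the center of `Hg(X₁)` contains an algebraic torus which is `ℚ`-isogenous to
`Hg(X₂)`»; for `X₁ = T` a type-IV(1,1) threefold and `X₂ = E`: `ℚ(√-d₂) ≅ ℚ(√-d₁)`).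
[cite: MoonenZarhin1999LowDim, §3 Lemma (3.6) and Prop. (3.8)] [cite: Deligne1982HodgeCycles, I §3 Prop. 3.6] -/
theorem incl_comp_proj_mem_hodgeLie_or_exists_traceSlopes_eq :
    ι₂.toLinearMap ∘ₗ φ₂ ∘ₗ π₂.toLinearMap ∈ H.hodgeLie ∨
      ∃ c : ℚ, ((LinearMap.trace ℚ V₁ (φ₁ * φ₁) : ℚ) : ℂ) * LinearMap.trace ℂ _ (Θ₂ * φ₂.baseChange ℂ) =
        (c : ℂ) * (LinearMap.trace ℂ _ (Θ₁ * φ₁.baseChange ℂ) * ((LinearMap.trace ℚ V₂ (φ₂ * φ₂) : ℚ) : ℂ)) := by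
  rcases center_dichotomy_of_cmCurve ι₁ π₁ ι₂ π₂ hπι₁ hπι₂ hsum hn heff₂ ψ₁ ψ₂ hZ₁ hφ₂E hd₂ hφ₂ hV₂ with
    h | ⟨z₀, -, x₀, y₀, hx₀, hy₀, hxz, hle⟩
  · exact Or.inl h
  · right
    obtain ⟨lam, h₁, h₂⟩ := exists_traces_eq_of_center_le_span ι₁ π₁ ι₂ π₂ hπι₁ hπι₂ hn heff₂ ψ ψ₂ hφ₁E hφ₂E hd₂ hφ₂ hV₂
      hΘ₁ hΘ₂ hx₀ hy₀ hle
    rcases hxz with hx | rfl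
    · refine ⟨y₀ / x₀, ?_⟩
      have hx' : (x₀ : ℂ) ≠ 0 := by exact_mod_cast hx
      rw [h₁, h₂, Rat.cast_div, div_mul_eq_mul_div, eq_div_iff hx']
      ring
    · -- `z₀ = 0`: both traces vanish
      have hx0 : x₀ • φ₁ = 0 := by rw [← hx₀, LinearMap.zero_comp, LinearMap.comp_zero]
      have hy0 : y₀ • φ₂ = 0 := by rw [← hy₀, LinearMap.zero_comp, LinearMap.comp_zero]
      refine ⟨0, ?_⟩
      have h₂' : LinearMap.trace ℂ _ (Θ₂ * φ₂.baseChange ℂ) = 0 := by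
        rw [h₂, mul_assoc, ← Rat.cast_mul, ← smul_eq_mul y₀, ← map_smul, ← smul_mul_assoc, hy0, zero_mul, map_zero,
          Rat.cast_zero, mul_zero]
      rw [h₂', mul_zero, Rat.cast_zero, zero_mul]

/-! ## §5 Non-resonance: `ι₂ φ₂ π₂ ∈ 𝔥(H)`, corner membership, `𝔥(H) = 𝔥(H₁) × 𝔥(H₂)` -/

variable (hres : ∀ c : ℚ, ((LinearMap.trace ℚ V₁ (φ₁ * φ₁) : ℚ) : ℂ) * LinearMap.trace ℂ _ (Θ₂ * φ₂.baseChange ℂ) ≠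
    (c : ℂ) * (LinearMap.trace ℂ _ (Θ₁ * φ₁.baseChange ℂ) * ((LinearMap.trace ℚ V₂ (φ₂ * φ₂) : ℚ) : ℂ)))

include hπι₁ hπι₂ hsum hn heff₂ ψ ψ₁ ψ₂ hφ₁E hZ₁ hφ₂E hd₂ hφ₂ hV₂ hΘ₁ hΘ₂ hres in
/-- **`ι₂ φ₂ π₂ ∈ 𝔥(H)` under non-resonance of the `Θ`-trace slopes** («`Hg(E) ⊆ Hg(X × E)`»: the rank-one torus of the CM curve is a
direct factor). [cite: MoonenZarhin1999LowDim, §3 Lemma (3.6) and Prop. (3.8)] -/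
theorem incl_comp_proj_mem_hodgeLie_of_traceSlopes : ι₂.toLinearMap ∘ₗ φ₂ ∘ₗ π₂.toLinearMap ∈ H.hodgeLie := by
  rcases incl_comp_proj_mem_hodgeLie_or_exists_traceSlopes_eq ι₁ π₁ ι₂ π₂ hπι₁ hπι₂ hsum hn heff₂ ψ ψ₁ ψ₂ hφ₁E hZ₁ hφ₂E hd₂
      hφ₂ hV₂ hΘ₁ hΘ₂ with h | ⟨c, hc⟩
  · exact h
  · exact absurd hc (hres c)

include hπι₁ hπι₂ hsum hn heff₂ ψ ψ₁ ψ₂ hφ₁E hZ₁ hφ₂E hd₂ hφ₂ hV₂ hΘ₁ hΘ₂ hres in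
/-- **Corner membership: `𝔥(H)` contains the first corner `ι₁ (π₁ X ι₁) π₁` of each of its elements** (the second block `ι₂ (π₂ X ι₂) π₂` is a
rational multiple of `ι₂ φ₂ π₂ ∈ 𝔥(H)`, and `X` is the sum of its two blocks). [cite: MoonenZarhin1999LowDim, §3 Lemma (3.6) and (3.1)]
[cite: Deligne1982HodgeCycles, I §3 Prop. 3.4 and Prop. 3.6] -/
theorem corner_mem_of_cmCurve_summand :
    ∀ X ∈ H.hodgeLie, ι₁.toLinearMap ∘ₗ (π₁.toLinearMap ∘ₗ X ∘ₗ ι₁.toLinearMap) ∘ₗ π₁.toLinearMap ∈ H.hodgeLie := by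
  intro X hX
  have hφ := incl_comp_proj_mem_hodgeLie_of_traceSlopes ι₁ π₁ ι₂ π₂ hπι₁ hπι₂ hsum hn heff₂ ψ ψ₁ ψ₂ hφ₁E hZ₁ hφ₂E hd₂ hφ₂ hV₂
    hΘ₁ hΘ₂ hres
  obtain ⟨c, hc⟩ := exists_restrict₂_eq_smul_of_cmCurve ι₂ π₂ hπι₂ hn heff₂ ψ₂ hφ₂E hd₂ hφ₂ hV₂ hX
  have hsplit := eq_sum_blocks_of_mem_hodgeLie ι₁ π₁ ι₂ π₂ hπι₁ hπι₂ hsum hX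
  have heq : ι₁.toLinearMap ∘ₗ (π₁.toLinearMap ∘ₗ X ∘ₗ ι₁.toLinearMap) ∘ₗ π₁.toLinearMap =
      X - c • (ι₂.toLinearMap ∘ₗ φ₂ ∘ₗ π₂.toLinearMap) := by
    rw [eq_sub_iff_add_eq, ← LinearMap.comp_smul, ← LinearMap.smul_comp, ← hc]
    exact hsplit.symm
  rw [heq]
  exact Submodule.sub_mem _ hX (Submodule.smul_mem _ _ hφ)

include hπι₁ hπι₂ hsum hn heff₂ ψ ψ₁ ψ₂ hφ₁E hZ₁ hφ₂E hd₂ hφ₂ hV₂ hΘ₁ hΘ₂ hres in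
/-- **`𝔥(H₁) × 𝔥(H₂) ≅ 𝔥(H)` and `dim_ℚ 𝔥(H) = dim_ℚ 𝔥(H₁) + dim_ℚ 𝔥(H₂)`** for a CM-elliptic-curve summand under non-resonance — Moonen–Zarhin's
«`Hg(X × E) = Hg(X) × Hg(E)` (or `End⁰(E) = k` embeds into the centre of `End⁰(X)`)» for the Lie algebra `hodgeLie`, with NO hypothesis on
`H₁` beyond the rank-one skew centre (`exists_linearEquiv_prod_hodgeLie_of_corner_mem`). [cite: MoonenZarhin1999LowDim, §3 Lemma (3.6) and Prop. (3.8)]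
[cite: Deligne1982HodgeCycles, I §3 Prop. 3.4 and Prop. 3.6] -/
theorem exists_linearEquiv_prod_and_finrank_hodgeLie_eq_add_of_cmCurve_summand :
    (∃ Φ : (H₁.hodgeLie × H₂.hodgeLie) ≃ₗ[ℚ] H.hodgeLie, ∀ Y : H₁.hodgeLie × H₂.hodgeLie,
      ((Φ Y : H.hodgeLie) : Module.End ℚ V) =
        ι₁.toLinearMap ∘ₗ (Y.1 : Module.End ℚ V₁) ∘ₗ π₁.toLinearMap + ι₂.toLinearMap ∘ₗ (Y.2 : Module.End ℚ V₂) ∘ₗ π₂.toLinearMap) ∧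
      Module.finrank ℚ H.hodgeLie = Module.finrank ℚ H₁.hodgeLie + Module.finrank ℚ H₂.hodgeLie := by
  obtain ⟨Φ, hΦ⟩ := exists_linearEquiv_prod_hodgeLie_of_corner_mem ι₁ π₁ ι₂ π₂ hπι₁ hπι₂ hsum
    (corner_mem_of_cmCurve_summand ι₁ π₁ ι₂ π₂ hπι₁ hπι₂ hsum hn heff₂ ψ ψ₁ ψ₂ hφ₁E hZ₁ hφ₂E hd₂ hφ₂ hV₂ hΘ₁ hΘ₂ hres)
  refine ⟨⟨Φ, hΦ⟩, ?_⟩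
  rw [← Φ.finrank_eq, Module.finrank_prod]

end Theta

end HodgeStructure

end Literature.AlgebraicGeometry.Motives

end
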